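import Literature.NumberTheory.Sieve.MoebiusShiftedPrimesArcs
import Literature.NumberTheory.Sieve.VinogradovExpSumTools
import Mathlib.NumberTheory.DiophantineApproximation.Basic
import HarnessLib

/-!
# Möbius on shifted primes — tools for the minor arcs of Lichtman 2020, §3.1

Topic `Literature/NumberTheory/Sieve`.  First proved ingredients of the future bottom-up proof of
the minor arc bound, display (3.1) of J. D. Lichtman, *Averages of the Möbius function on shifted
primes*, arXiv:2009.08969 [Lichtman2020] (`Lichtman2020_minorArcBound31` of
`MoebiusShiftedPrimesMinorArcForm.lean`; pp. 9–10 of the held copy `paper:arxiv-2009.08969`):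

* `Lichtman2020.exists_rat_of_mem_minorArcs` — Dirichlet's approximation on the minor arcs
  `𝔪 = lichtmanMinorArcs W Q₁` (p. 9): a reduced `a/q` with `W < q ≤ Q₁`, `|α - a/q| ≤ 1/(qQ₁)`
  (Mathlib's `Real.exists_rat_abs_sub_le_and_den_le`).
* `Lichtman2020.ramare_identity` — the combinatorial core of the Ramaré identity (3.2):
  `∑_{p ∈ 𝒫, p ∣ n} 1/(#{q ∈ 𝒫 : q ∣ n/p} + 𝟙[p ∤ n/p]) = 1` when `n` has a prime factor in `𝒫`.
* `Lichtman2020.sum_geomBound_le_of_mem_minorArcs` — Lemma 3.3 ("Vinogradov's lemma [IK]") on the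
  minor arcs, in the explicit form of the tree's `Literature.NumberTheory.Sieve.Vinogradov.sum_geomBound_div_le`
  (Nathanson, Lemma 4.10): `∑_{k ≤ U} min(N/k, 1/(2‖αk‖)) ≤ 4(N/W + U + Q₁)(1 + log(Q₁U))` for
  `α ∈ 𝔪`.  (The printed Lemma 3.3, "`≪ H/q + H/P + (P+q) log q`", has no logarithm on `H/q`; the
  proved form does — see the notes of `MoebiusShiftedPrimesMinorArcForm.lean` on why this is harmless
  for Theorem 2.2.)

The remaining steps of §3.1 (dyadic decomposition, Cauchy–Schwarz (3.5), the geometric series and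
the prime-pair count (3.6) via `PrimePairsSieveBound.lean`) are not yet formalised.
-/

namespace Literature.NumberTheory.Sieve.Lichtman2020

open Filter Finset

/-! ### Diophantine data on the minor arcs -/

/-- **Dirichlet's approximation on the minor arcs** (p. 9: "By Dirichlet's approximation theorem
there exists `a/q ∈ ℚ` with `(a,q) = 1` and `1 ≤ q ≤ Q₁` for which `|α - a/q| ≤ 1/(qQ₁)`" and
"for `α ∈ 𝔪` in the minor arc, `|α - a/q| < W⁴/qH` with `q ∈ [W, H/W⁴]`"): every `α ∈ 𝔪` has a
reduced fraction `a/q` with `W < q ≤ Q₁` and `|α - a/q| ≤ 1/(qQ₁)` (Mathlib's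
`Real.exists_rat_abs_sub_le_and_den_le`; `q ≤ W` would put `α` in `𝔐(q)`). [cite: Lichtman2020, §3, p. 9] -/
theorem exists_rat_of_mem_minorArcs {W Q₁ α : ℝ} (hQ₁ : 1 ≤ Q₁)
    (hα : α ∈ lichtmanMinorArcs W Q₁) :
    ∃ (a : ℤ) (q : ℕ), 1 ≤ q ∧ W < q ∧ (q : ℝ) ≤ Q₁ ∧ Int.gcd a q = 1 ∧
      |α - a / q| ≤ 1 / (q * Q₁) := by
  set n : ℕ := ⌊Q₁⌋₊ with hn
  have hn1 : 1 ≤ n := Nat.le_floor (by exact_mod_cast hQ₁)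
  have hnQ : (n : ℝ) ≤ Q₁ := Nat.floor_le (by linarith)
  have hQn : Q₁ < n + 1 := Nat.lt_floor_add_one Q₁
  obtain ⟨r, hr, hden⟩ := Real.exists_rat_abs_sub_le_and_den_le α (by omega : 0 < n)
  have hd0 : 0 < r.den := r.den_pos
  have hd0' : (0 : ℝ) < r.den := by exact_mod_cast hd0
  refine ⟨r.num, r.den, hd0, ?_, le_trans (by exact_mod_cast hden) hnQ, ?_, ?_⟩
  · -- `q ≤ W` would put `α` in the major arc `𝔐(q)`
    by_contra hW
    push Not at hW
    apply hα.2
    simp only [lichtmanMajorArcs, lichtmanMajorArc, Set.mem_iUnion, Set.mem_setOf_eq]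
    refine ⟨r.den, ⟨hd0, hW⟩, r.num, ?_, ?_⟩
    · show Nat.gcd r.num.natAbs r.den = 1
      exact r.reduced
    · calc |α - (r.num : ℝ) / (r.den : ℕ)| = |α - r| := by
            rw [show ((r.num : ℝ) / (r.den : ℕ) : ℝ) = (r : ℝ) by
              rw [Rat.cast_def]]
        _ ≤ 1 / ((n + 1) * r.den) := hr
        _ ≤ 1 / ((r.den : ℕ) * Q₁) := by
            apply one_div_le_one_div_of_le (by positivity)
            nlinarith
  · show Nat.gcd r.num.natAbs r.den = 1
    exact r.reduced
  · calc |α - (r.num : ℝ) / (r.den : ℕ)| = |α - r| := by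
          rw [show ((r.num : ℝ) / (r.den : ℕ) : ℝ) = (r : ℝ) by rw [Rat.cast_def]]
      _ ≤ 1 / ((n + 1) * r.den) := hr
      _ ≤ 1 / ((r.den : ℕ) * Q₁) := by
          apply one_div_le_one_div_of_le (by positivity)
          nlinarith

end Literature.NumberTheory.Sieve.Lichtman2020

namespace Literature.NumberTheory.Sieve.Lichtman2020

open Finset

/-! ### The Ramaré identity (3.2) -/

/-- For a prime `p ∣ n` (`n ≠ 0`) and a set of primes `𝒫 ∋ p`:
`#{q ∈ 𝒫 : q ∣ n} = #{q ∈ 𝒫 : q ∣ n/p} + 𝟙[p ∤ n/p]`. [folklore] -/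
theorem card_filter_dvd_eq_card_filter_dvd_div (Ps : Finset ℕ) (hPs : ∀ q ∈ Ps, q.Prime) {n p : ℕ}
    (hn : n ≠ 0) (hp : p ∈ Ps) (hpn : p ∣ n) :
    #(Ps.filter (· ∣ n)) = #(Ps.filter (· ∣ n / p)) + if p ∣ n / p then 0 else 1 := by
  have hpp := hPs p hp
  obtain ⟨m, rfl⟩ := hpn
  have hm : m ≠ 0 := by rintro rfl; simp at hn
  rw [Nat.mul_div_cancel_left m hpp.pos]
  -- `{q ∈ Ps : q ∣ pm} = {q ∈ Ps : q ∣ m} ∪ {p}`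
  have hset : Ps.filter (· ∣ p * m) = insert p (Ps.filter (· ∣ m)) := by
    ext q
    rw [Finset.mem_insert, Finset.mem_filter, Finset.mem_filter]
    constructor
    · rintro ⟨hq, hdvd⟩
      by_cases hqp : q = p
      · exact Or.inl hqp
      · right
        refine ⟨hq, ?_⟩
        have hcop : Nat.Coprime q p := (Nat.coprime_primes (hPs q hq) hpp).mpr hqp
        exact hcop.dvd_of_dvd_mul_left hdvd
    · rintro (rfl | ⟨hq, hdvd⟩)
      · exact ⟨hp, dvd_mul_right _ _⟩
      · exact ⟨hq, hdvd.mul_left _⟩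
  rw [hset]
  by_cases hpm : p ∣ m
  · rw [if_pos hpm, add_zero, Finset.insert_eq_of_mem (Finset.mem_filter.mpr ⟨hp, hpm⟩)]
  · have hnot : p ∉ Ps.filter (· ∣ m) := fun h => hpm (Finset.mem_filter.mp h).2
    rw [if_neg hpm, Finset.card_insert_of_notMem hnot]

/-- **The Ramaré identity, (3.2)** of Lichtman 2020 (p. 9: "`𝟙_{S_d}(n) = ∑_{p ∈ 𝒫, n = mp}
𝟙_{S^{(1)}_d}(mp)/(#{q ∈ 𝒫 : q ∣ m} + 𝟙_{p ∤ m})`"), in its combinatorial core: if `n ≠ 0` has a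
prime factor in the finite set of primes `𝒫`, then
`∑_{p ∈ 𝒫, p ∣ n} 1/(#{q ∈ 𝒫 : q ∣ n/p} + 𝟙[p ∤ n/p]) = 1` (each weight equals `1/#{q ∈ 𝒫 : q ∣ n}`).
[cite: Lichtman2020, (3.2)] -/
theorem ramare_identity (Ps : Finset ℕ) (hPs : ∀ q ∈ Ps, q.Prime) {n : ℕ} (hn : n ≠ 0)
    (hex : ∃ p ∈ Ps, p ∣ n) :
    ∑ p ∈ Ps.filter (· ∣ n),
      (1 : ℝ) / (#(Ps.filter (· ∣ n / p)) + if p ∣ n / p then (0 : ℝ) else 1) = 1 := by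
  set F := Ps.filter (· ∣ n) with hF
  have hFne : F.Nonempty := by
    obtain ⟨p, hp, hpn⟩ := hex
    exact ⟨p, Finset.mem_filter.mpr ⟨hp, hpn⟩⟩
  have hF0 : (0 : ℝ) < #F := by exact_mod_cast hFne.card_pos
  have hterm : ∀ p ∈ F,
      (1 : ℝ) / (#(Ps.filter (· ∣ n / p)) + if p ∣ n / p then (0 : ℝ) else 1) = 1 / #F := by
    intro p hp
    rw [Finset.mem_filter] at hp
    have h := card_filter_dvd_eq_card_filter_dvd_div Ps hPs hn hp.1 hp.2
    rw [hF, h]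
    push_cast
    split_ifs <;> simp
  rw [Finset.sum_congr rfl hterm, Finset.sum_const, nsmul_eq_mul]
  field_simp

end Literature.NumberTheory.Sieve.Lichtman2020

namespace Literature.NumberTheory.Sieve.Lichtman2020

open Finset

/-! ### Vinogradov's lemma on the minor arcs -/

/-- **Lemma 3.3 (the "standard Vinogradov lemma [IK]") on the minor arcs**, in the explicit form of
the tree's `Literature.NumberTheory.Sieve.Vinogradov.sum_geomBound_div_le` (Nathanson, Lemma 4.10:
`∑_{k ≤ U} min(N/k, 1/(2‖αk‖)) ≤ 4(N/q + U + q)(1 + log(qU))` for `|α - a/q| ≤ q⁻²`, `(a,q) = 1`):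
for `α ∈ 𝔪 = lichtmanMinorArcs W Q₁` (`Q₁ ≥ 1`) and `1 ≤ U`, `N ≥ 0`,
`∑_{k ≤ U} min(N/k, 1/(2‖αk‖)) ≤ 4 (N/W + U + Q₁)(1 + log(Q₁ U))`, since the Dirichlet fraction of
`α` has `W < q ≤ Q₁` (`exists_rat_of_mem_minorArcs`).  Printed (p. 10): "`∑_{1 ≤ n ≤ P} min(H/n, 1/‖nα‖)
≪ H/q + H/P + (P+q) log q`" and "`H/q + H/P + (P+q) log q ≪ H/W` since `q ∈ [W, H/W⁴]`,
`P ∈ [W^{24}, H/W⁴]`" — note the logarithm multiplies `N/q` as well in the proved form.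
[cite: Lichtman2020, Lemma 3.3] [cite: Nathanson1996, §4.4, Lemma 4.10] -/
theorem sum_geomBound_le_of_mem_minorArcs {W Q₁ α N : ℝ} (hW : 0 < W) (hQ₁ : 1 ≤ Q₁)
    (hα : α ∈ lichtmanMinorArcs W Q₁) (hN : 0 ≤ N) {U : ℕ} (hU : 1 ≤ U) :
    ∑ k ∈ Icc 1 U, Vinogradov.geomBound (N / k) (α * k) ≤
      4 * (N / W + U + Q₁) * (1 + Real.log (Q₁ * U)) := by
  obtain ⟨a, q, hq1, hWq, hqQ, hgcd, hαq⟩ := exists_rat_of_mem_minorArcs hQ₁ hα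
  have hq0 : (0 : ℝ) < q := by exact_mod_cast hq1
  have hU0 : (0 : ℝ) < U := by exact_mod_cast hU
  have hcop : IsCoprime a (q : ℤ) := Int.isCoprime_iff_gcd_eq_one.mpr hgcd
  have hα2 : |α - a / q| ≤ 1 / (q : ℝ) ^ 2 := by
    refine hαq.trans ?_
    rw [sq]
    exact one_div_le_one_div_of_le (by positivity) (mul_le_mul_of_nonneg_left hqQ hq0.le)
  have h := Vinogradov.sum_geomBound_div_le hq1 hcop hα2 hN hU
  refine h.trans ?_
  have hlog1 : 0 ≤ 1 + Real.log ((q : ℝ) * U) := by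
    have hq1' : (1 : ℝ) ≤ q := by exact_mod_cast hq1
    have hU1' : (1 : ℝ) ≤ U := by exact_mod_cast hU
    have : (1 : ℝ) ≤ (q : ℝ) * U := by nlinarith
    have := Real.log_nonneg this
    linarith
  have hlog2 : Real.log ((q : ℝ) * U) ≤ Real.log (Q₁ * U) :=
    Real.log_le_log (by positivity) (mul_le_mul_of_nonneg_right hqQ hU0.le)
  have h1 : N / q ≤ N / W := div_le_div_of_nonneg_left hN hW hWq.le
  have hsum0 : 0 ≤ N / W + U + Q₁ := by positivity
  calc 4 * (N / q + U + q) * (1 + Real.log ((q : ℝ) * U))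
      ≤ 4 * (N / W + U + Q₁) * (1 + Real.log ((q : ℝ) * U)) := by
        apply mul_le_mul_of_nonneg_right _ hlog1
        linarith
    _ ≤ 4 * (N / W + U + Q₁) * (1 + Real.log (Q₁ * U)) := by
        apply mul_le_mul_of_nonneg_left _ (by positivity)
        linarith

end Literature.NumberTheory.Sieve.Lichtman2020
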